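import Mathlib.Computability.TuringMachine.Computable
import Mathlib.Computability.StateTransition
import Mathlib.Data.Nat.Log
import Literature.Computability.Complexity.TimeBounds
import Literature.Computability.Complexity.BoolEncodings
import Literature.Computability.Complexity.Classes
import Literature.Computability.Complexity.Nondeterministic
import HarnessLib

-- provenance: harness21/H21/H21/Prelude/CplxCore/Space.lean @ 7a08ad6 (interim HEAD d8f2665); M5 mechanical rewrite
/-!
# Complexity core: space-bounded computation and space classes

Trunk `CplxCore`, concept C16 (`Space`; realises `space_bounded_classes`): deterministic
space-bounded computation on Mathlib's multi-stack machines `Turing.FinTM2` /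
`Turing.TM2ComputableAux Γ₀ Γ₁`, and the classes `DSPACE s`, `LOGSPACE` (= L), `PSPACE`,
`DTISP t s`, together with `IsSpaceConstructible`.

## The model (outline D4, review F2/F5, risk R9)

Sublinear space needs a read-only input. A `SpaceMachine Γ₀ Γ₁` is a `TM2ComputableAux` with a
designated second input-alphabet stack `kL` (distinct from the input stack `k₀` and the output
stack `k₁`). The *semantic* side condition `SpaceMachine.IsInputPreserving` says that in every
configuration reachable from the initial one, `reverse (stk kL) ++ stk k₀ = input`: the two stacks
`kL`, `k₀` together form a two-way read-only input tape with the head between them. The work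
space of a configuration is the total length of all other stacks (the output stack `k₁` counts as
work space; there is no `FL`/log-space transducer in v0). Two stacks simulate one tape exactly in
space, so `DSPACE` agrees with the textbook multitape class up to the constant in its definition
(folklore, unstated).

Reachability and halting use Mathlib's `StateTransition.Reaches tm.step`,
`StateTransition.eval tm.step` (`StateTransition.mem_eval : b ∈ eval f a ↔ Reaches f a b ∧
f b = none`) and `StateTransition.EvalsToInTime` — a space machine halts in any configuration
`c` with `tm.step c = none`, and the answer is read off `c.stk k₁`. We do NOT use
`Turing.TM2Outputs`/`Turing.haltList`: `haltList` requires all stacks but `k₁` to be empty at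
halt, which contradicts input preservation (every class would be empty). `TM2Outputs` moreover
pins `var = initialState` at halt; these are constant-overhead Mathlib quirks that our halting
notion does not impose, relevant only inside simulations such as `P ⊆ PSPACE` (sorried theorems).
Nondeterministic space is out of scope.

Mathlib has no space-bounded computation or space classes (searched: `DSPACE`, `PSPACE`,
`LOGSPACE`, `SpaceConstructible`, `workSpace` — nothing). We reuse `Turing.initList`,
`Turing.TM2.Cfg.stk`, `Turing.FinTM2.step`, `StateTransition.Reaches/eval/EvalsToInTime`,
`Computability.encodeBool`, `Computability.unaryEncodeNat`, `Computability.encodeNat`,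
`Nat.log`.

## Design notes

* Big-O is built in arithmetically (outline D2): `DSPACE s = {L | ∃ c, L ∈ SpaceClass (c*s+c)}`.
  In particular `LOGSPACE = DSPACE (Nat.log 2)` is insensitive to `Nat.log 2 0 = Nat.log 2 1 = 0`.
* `DTISP t s` (simultaneous time–space) uses `HaltsWithIn`; as for `DTIME`, one step pops `O(1)`
  symbols, so a per-input time bound must dominate the input length (outline D1 halting rule);
  the `+ c` and the read-only input make `DTISP t s` meaningful for `t n ≥ n`.
* Class names are the customary acronyms inside `namespace Literature.CplxCore` (outline D7).
* Definitions mentioning `Set.boolIndicator` are `noncomputable`.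

## References

* S. Arora, B. Barak, *Computational Complexity: A Modern Approach*, CUP 2009, Def. 4.1
  (space-bounded computation, SPACE, read-only input), Def. 4.5 (PSPACE, L), Thm 4.2
  (DTIME(s) ⊆ SPACE(s) ⊆ DTIME(2^{O(s)})), §4.1 (space-constructible), Def. 5.10/§5 (TISP).
* M. Sipser, *Introduction to the Theory of Computation*, 3rd ed., Def. 8.1 (space complexity,
  SPACE), Def. 8.6 (PSPACE), Def. 8.17 (L, read-only input two-tape model), Thm 8.5/§8.2–8.4.
* J. Hartmanis, P. Lewis, R. Stearns, *Hierarchies of memory limited computations*, 1965.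
-/

namespace Literature.Computability.Complexity

open _root_.Computability Turing StateTransition

variable {Γ₀ Γ₁ : Type}

/-! ### Space machines -/

/-- A deterministic multi-stack machine with a two-stack read-only input: a
`Turing.TM2ComputableAux Γ₀ Γ₁` (machine `tm` with input stack `tm.k₀`, output stack `tm.k₁`,
alphabet equivalences) together with a designated *left input stack* `kL ≠ k₀, k₁` whose
alphabet is identified with `Γ₀`. The intended invariant `reverse (stk kL) ++ stk k₀ = input`
is the separate predicate `SpaceMachine.IsInputPreserving` (a hypothesis structure, outline D4).
[Sipser, Def. 8.17 (read-only input tape model); Arora–Barak 2009, Def. 4.1] [cite: AroraBarak2009, Def. 4.1] -/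
structure SpaceMachine (Γ₀ Γ₁ : Type) extends TM2ComputableAux Γ₀ Γ₁ where
  /-- The left half of the read-only input (symbols already scanned, in reverse). -/
  kL : tm.K
  /-- The left input stack is distinct from the (right) input stack. -/
  kL_ne_k₀ : kL ≠ tm.k₀
  /-- The left input stack is distinct from the output stack. -/
  kL_ne_k₁ : kL ≠ tm.k₁
  /-- The alphabet of the left input stack is the input alphabet. -/
  leftAlphabet : tm.Γ kL ≃ Γ₀

namespace SpaceMachine

/-- The initial configuration of a space machine on input `l : List Γ₀`: Mathlib's
`Turing.initList` on the input transported along `inputAlphabet` (input on stack `k₀`, all other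
stacks empty). [Arora–Barak 2009, Def. 4.1; Mathlib `Turing.initList`] [cite: AroraBarak2009, Def. 4.1] -/
def init (M : SpaceMachine Γ₀ Γ₁) (l : List Γ₀) : M.tm.Cfg :=
  initList M.tm (l.map M.inputAlphabet.symm)

/-- `M.IsInputPreserving`: in every configuration reachable (`StateTransition.Reaches M.tm.step`)
from `M.init l`, the stacks `kL` (reversed) and `k₀` concatenate to the input `l`; i.e. `M` treats
`kL`/`k₀` as a two-way read-only input tape. [Sipser, Def. 8.17; Arora–Barak 2009, Def. 4.1
(read-only input tape)] [cite: AroraBarak2009, Def. 4.1 (read-only input tape] -/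
def IsInputPreserving (M : SpaceMachine Γ₀ Γ₁) : Prop :=
  ∀ (l : List Γ₀) (c : M.tm.Cfg), Reaches M.tm.step (M.init l) c →
    ((c.stk M.kL).map M.leftAlphabet).reverse ++ (c.stk M.tm.k₀).map M.inputAlphabet = l

/-- The work space used by a configuration: the total length of all stacks other than the two
input stacks `k₀`, `kL` (the output stack `k₁` counts as work space).
[Arora–Barak 2009, Def. 4.1 (only work tapes are charged); Sipser, Def. 8.17] [cite: AroraBarak2009, Def. 4.1 (only work tapes are charged] -/
def workSpace (M : SpaceMachine Γ₀ Γ₁) (c : M.tm.Cfg) : ℕ :=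
  haveI := M.tm.kFin
  ∑ k ∈ (Finset.univ.erase M.tm.k₀).erase M.kL, (c.stk k).length

/-- `M.RunsInSpace l s`: every configuration reachable from `M.init l` uses work space `≤ s`.
[Arora–Barak 2009, Def. 4.1; Sipser, Def. 8.1] [cite: AroraBarak2009, Def. 4.1] -/
def RunsInSpace (M : SpaceMachine Γ₀ Γ₁) (l : List Γ₀) (s : ℕ) : Prop :=
  ∀ c : M.tm.Cfg, Reaches M.tm.step (M.init l) c → M.workSpace c ≤ s

/-- `M.HaltsWith l l' c`: started on `l`, the machine halts in configuration `c`
(`c ∈ StateTransition.eval M.tm.step (M.init l)`, i.e. `c` is reachable and `M.tm.step c = none`,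
by `StateTransition.mem_eval`) and the output stack `k₁` of `c` reads `l'`. Unlike
`Turing.TM2Outputs`, no condition on `var` or on the other stacks is imposed (module docstring).
[Arora–Barak 2009, Def. 4.1; Mathlib `StateTransition.eval`] [cite: AroraBarak2009, Def. 4.1] -/
def HaltsWith (M : SpaceMachine Γ₀ Γ₁) (l : List Γ₀) (l' : List Γ₁) (c : M.tm.Cfg) : Prop :=
  c ∈ eval M.tm.step (M.init l) ∧ (c.stk M.tm.k₁).map M.outputAlphabet = l'

/-- `M.HaltsWithIn l l' c m`: started on `l`, the machine reaches the halting configuration `c`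
(`M.tm.step c = none`) within `m` steps (`StateTransition.EvalsToInTime`), with output `l'` on
stack `k₁`. [Arora–Barak 2009, Def. 4.1 and §5.4 (TISP); Mathlib `StateTransition.EvalsToInTime`] [cite: AroraBarak2009, Def. 4.1 and §5.4 (TISP] -/
def HaltsWithIn (M : SpaceMachine Γ₀ Γ₁) (l : List Γ₀) (l' : List Γ₁) (c : M.tm.Cfg) (m : ℕ) :
    Prop :=
  Nonempty (EvalsToInTime M.tm.step (M.init l) (some c) m) ∧ M.tm.step c = none ∧
    (c.stk M.tm.k₁).map M.outputAlphabet = l'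

/-- `none` is a fixed point of the lifted step function `flip bind f`.
[Mathlib `StateTransition.EvalsTo`] [folklore] -/
private theorem iterate_flip_bind_none {σ : Type} (f : σ → Option σ) (n : ℕ) :
    (flip bind f)^[n] none = none := by
  induction n with
  | zero => rfl
  | succ n ih => rw [Function.iterate_succ_apply]; exact ih

/-- Bridge between Mathlib's step-counting `(flip bind f)^[n]` (used by `EvalsTo`) and the
relational `StateTransition.Reaches`. [Mathlib `StateTransition.EvalsTo`, `Reaches`] [folklore] -/
theorem _root_.StateTransition.reaches_of_iterate_flip_bind {σ : Type} (f : σ → Option σ)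
    (n : ℕ) (a b : σ) (h : (flip bind f)^[n] (some a) = some b) : Reaches f a b := by
  induction n generalizing a with
  | zero =>
    simp only [Function.iterate_zero, id_eq, Option.some.injEq] at h
    subst h
    exact Relation.ReflTransGen.refl
  | succ n ih =>
    rw [Function.iterate_succ_apply] at h
    change (flip bind f)^[n] (f a) = some b at h
    cases hfa : f a with
    | none =>
      rw [hfa, iterate_flip_bind_none] at h
      exact absurd h (by simp)
    | some a' =>
      rw [hfa] at h
      exact Relation.ReflTransGen.head (by simpa using hfa) (ih a' h)

/-- Halting within `m` steps implies halting. [Mathlib `StateTransition.mem_eval`] [folklore] -/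
theorem HaltsWithIn.haltsWith {M : SpaceMachine Γ₀ Γ₁} {l : List Γ₀} {l' : List Γ₁}
    {c : M.tm.Cfg} {m : ℕ} (h : M.HaltsWithIn l l' c m) : M.HaltsWith l l' c := by
  obtain ⟨⟨e⟩, hs, ho⟩ := h
  exact ⟨mem_eval.2 ⟨reaches_of_iterate_flip_bind _ e.steps _ _ e.evals_in_steps, hs⟩, ho⟩

/-- Monotonicity of `HaltsWithIn` in the time bound. [Mathlib `StateTransition.EvalsToInTime`] [folklore] -/
theorem HaltsWithIn.mono {M : SpaceMachine Γ₀ Γ₁} {l : List Γ₀} {l' : List Γ₁}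
    {c : M.tm.Cfg} {m m' : ℕ} (h : M.HaltsWithIn l l' c m) (hm : m ≤ m') :
    M.HaltsWithIn l l' c m' := by
  obtain ⟨⟨e⟩, hs, ho⟩ := h
  exact ⟨⟨⟨e.toEvalsTo, e.steps_le_m.trans hm⟩⟩, hs, ho⟩

/-- Monotonicity of `RunsInSpace` in the space bound. [Arora–Barak 2009, Def. 4.1] [cite: AroraBarak2009, Def. 4.1] -/
theorem RunsInSpace.mono {M : SpaceMachine Γ₀ Γ₁} {l : List Γ₀} {s s' : ℕ}
    (h : M.RunsInSpace l s) (hs : s ≤ s') : M.RunsInSpace l s' :=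
  fun c hc => (h c hc).trans hs

end SpaceMachine

/-! ### Deciding languages in bounded space -/

/-- `DecidesInSpace M L S`: the Boolean space machine `M` is input preserving and, on every
input `x : List Bool`, halts with output `encodeBool (L.boolIndicator x)` (i.e. `[true]` iff
`x ∈ L`) using work space at most `S x` throughout the run. Noncomputable (`Set.boolIndicator`).
[Arora–Barak 2009, Def. 4.1 (L ∈ SPACE(s)); Sipser, Def. 8.1, 8.17] [cite: AroraBarak2009, Def. 4.1 (L ∈ SPACE(s] -/
noncomputable def DecidesInSpace (M : SpaceMachine Bool Bool) (L : Language Bool)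
    (S : List Bool → ℕ) : Prop :=
  M.IsInputPreserving ∧
    ∀ x, (∃ c, M.HaltsWith x (encodeBool (L.boolIndicator x)) c) ∧ M.RunsInSpace x (S x)

/-- `DecidesInTimeSpace M L T S`: as `DecidesInSpace`, but `M` moreover halts within `T x`
steps on input `x` (simultaneous time–space bound). Noncomputable (`Set.boolIndicator`).
[Arora–Barak 2009, Def. 5.10 (TISP); Sipser, Def. 8.1] [cite: AroraBarak2009, Def. 5.10 (TISP] -/
noncomputable def DecidesInTimeSpace (M : SpaceMachine Bool Bool) (L : Language Bool)
    (T S : List Bool → ℕ) : Prop :=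
  M.IsInputPreserving ∧
    ∀ x, (∃ c, M.HaltsWithIn x (encodeBool (L.boolIndicator x)) c (T x)) ∧
      M.RunsInSpace x (S x)

/-- A simultaneous time–space decider is in particular a space decider.
[Arora–Barak 2009, Def. 4.1, 5.10] [cite: AroraBarak2009, Def. 4.1  5.10] -/
theorem DecidesInTimeSpace.decidesInSpace {M : SpaceMachine Bool Bool} {L : Language Bool}
    {T S : List Bool → ℕ} (h : DecidesInTimeSpace M L T S) : DecidesInSpace M L S :=
  ⟨h.1, fun x => ⟨(h.2 x).1.imp fun _ hc => hc.haltsWith, (h.2 x).2⟩⟩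

/-! ### Space classes -/

/-- `SpaceClass s`: the languages `L ⊆ {0,1}*` decided by some input-preserving space machine
using work space at most `s n` on every input of length `n` (exact-bound primitive; `DSPACE s`
is its big-O closure). [Sipser, Def. 8.1 (SPACE(f(n))); Arora–Barak 2009, Def. 4.1] [cite: AroraBarak2009, Def. 4.1] -/
noncomputable def SpaceClass (s : ℕ → ℕ) : Set (Language Bool) :=
  {L | ∃ M : SpaceMachine Bool Bool, DecidesInSpace M L (fun x => s x.length)}

/-- `DSPACE s`: languages decidable in deterministic space `O(s n)`, in the arithmetic form
`∃ c, L ∈ SpaceClass (fun n => c * s n + c)` (outline D2).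
[Arora–Barak 2009, Def. 4.1 (SPACE(s(n))); Sipser, Def. 8.1] [cite: AroraBarak2009, Def. 4.1 (SPACE(s(n] -/
noncomputable def DSPACE (s : ℕ → ℕ) : Set (Language Bool) :=
  {L | ∃ c : ℕ, L ∈ SpaceClass (fun n => c * s n + c)}

/-- The class `LOGSPACE` (usually `L`) `= DSPACE(log n)`, with `Nat.log 2`.
[Arora–Barak 2009, Def. 4.5; Sipser, Def. 8.17] [cite: AroraBarak2009, Def. 4.5] -/
noncomputable def LOGSPACE : Set (Language Bool) :=
  DSPACE (Nat.log 2)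

/-- The class `PSPACE = ⋃ₖ DSPACE(nᵏ)`. [Arora–Barak 2009, Def. 4.5; Sipser, Def. 8.6] [cite: AroraBarak2009, Def. 4.5] -/
noncomputable def PSPACE : Set (Language Bool) :=
  ⋃ k : ℕ, DSPACE (fun n => n ^ k)

/-- `TimeSpaceClass t s`: languages decided by some input-preserving space machine
simultaneously within `t n` steps and work space `s n` on inputs of length `n` (exact bounds).
[Arora–Barak 2009, Def. 5.10 (TISP)] [cite: AroraBarak2009, Def. 5.10 (TISP] -/
noncomputable def TimeSpaceClass (t s : ℕ → ℕ) : Set (Language Bool) :=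
  {L | ∃ M : SpaceMachine Bool Bool,
    DecidesInTimeSpace M L (fun x => t x.length) (fun x => s x.length)}

/-- `DTISP t s`: languages decidable simultaneously in time `O(t n)` and space `O(s n)` by a
single machine (arithmetic big-O with one constant `c` for both bounds, outline D2).
[Arora–Barak 2009, Def. 5.10 (TISP(T, S)); Fortnow 2000; Williams 2008] [cite: AroraBarak2009, Def. 5.10 (TISP(T  S] -/
noncomputable def DTISP (t s : ℕ → ℕ) : Set (Language Bool) :=
  {L | ∃ c : ℕ, L ∈ TimeSpaceClass (fun n => c * t n + c) (fun n => c * s n + c)}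

/-- `IsSpaceConstructible s`: the map `1ⁿ ↦ ⟨s n⟩₂` (unary input `unaryEncodeNat`, binary output
`encodeNat` on the output stack) is computable by an input-preserving space machine using work
space `O(s n)`. No lower bound `s n ≥ log n` is imposed (add it as a hypothesis where needed).
[Arora–Barak 2009, §4.1 (space-constructible functions); Sipser, Def. 9.1;
Hartmanis–Lewis–Stearns 1965] [cite: AroraBarak2009, §4.1 (space-constructible functions] -/
def IsSpaceConstructible (s : ℕ → ℕ) : Prop :=
  ∃ (M : SpaceMachine Bool Bool) (c : ℕ), M.IsInputPreserving ∧
    ∀ n : ℕ, (∃ cfg, M.HaltsWith (unaryEncodeNat n) (encodeNat (s n)) cfg) ∧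
      M.RunsInSpace (unaryEncodeNat n) (c * s n + c)

/-! ### API -/

/-- Monotonicity of the exact space class in the space bound. [Sipser, Def. 8.1] [folklore] -/
theorem spaceClass_mono {s s' : ℕ → ℕ} (h : ∀ n, s n ≤ s' n) : SpaceClass s ⊆ SpaceClass s' :=
  fun _ ⟨M, hM⟩ => ⟨M, hM.1, fun x => ⟨(hM.2 x).1, (hM.2 x).2.mono (h _)⟩⟩

/-- Monotonicity of `DSPACE` in the space bound. [Arora–Barak 2009, Def. 4.1] [cite: AroraBarak2009, Def. 4.1] -/
theorem DSPACE_mono {s s' : ℕ → ℕ} (h : ∀ n, s n ≤ s' n) : DSPACE s ⊆ DSPACE s' :=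
  fun _ ⟨c, hc⟩ => ⟨c, spaceClass_mono (fun n => by have := h n; gcongr) hc⟩

/-- `DTISP t s ⊆ DSPACE s`. [Arora–Barak 2009, Def. 5.10] [cite: AroraBarak2009, Def. 5.10] -/
theorem DTISP_subset_DSPACE (t s : ℕ → ℕ) : DTISP t s ⊆ DSPACE s :=
  fun _ ⟨c, M, hM⟩ => ⟨c, M, hM.decidesInSpace⟩

/-- `L ⊆ PSPACE`. [Arora–Barak 2009, §4.1; Sipser, §8.4] [cite: AroraBarak2009, §4.1] -/
theorem LOGSPACE_subset_PSPACE : LOGSPACE ⊆ PSPACE := fun L hL =>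
  Set.mem_iUnion.2 ⟨1, DSPACE_mono (fun n => by simpa using Nat.log_le_self 2 n) hL⟩

/-- `DTIME(t) ⊆ DSPACE(t)`: a machine running for `O(t n)` steps touches `O(t n)` cells
(simulation of a `TM2OutputsInTime` machine by an input-preserving space machine that first
copies its input to a work stack). [Arora–Barak 2009, Thm 4.2; Sipser, proof of Thm 8.5] [cite: AroraBarak2009, Thm 4.2] -/
def DTIME_subset_DSPACE : Prop :=
  ∀ (t : ℕ → ℕ),
    DTIME t ⊆ DSPACE t

/-- `P ⊆ PSPACE`. [Arora–Barak 2009, Thm 4.2 / §4.1; Sipser, Thm 8.5 ff.] [cite: AroraBarak2009, Thm 4.2 / §4.1] -/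
def P_subset_PSPACE : Prop :=
  Classes.P ⊆ PSPACE

/-- `NP ⊆ PSPACE` (enumerate all witnesses, reusing space). [Arora–Barak 2009, §4.1
(Claim after Def. 4.5: NP ⊆ PSPACE); Sipser, Thm 8.5 ff. (SAT ∈ PSPACE)] [cite: AroraBarak2009, §4.1 (Claim after Def. 4.5: NP ⊆ PSPACE] -/
def NP_subset_PSPACE : Prop :=
  Nondeterministic.NP ⊆ PSPACE

/-- `PSPACE ⊆ EXP` (a space-`s` machine has `2^{O(s)}` configurations).
[Arora–Barak 2009, Thm 4.2 (SPACE(s) ⊆ DTIME(2^{O(s)})); Sipser, Lemma 5.8 (configuration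
count)] [cite: AroraBarak2009, Thm 4.2 (SPACE(s] -/
def PSPACE_subset_EXP : Prop :=
  PSPACE ⊆ EXP

/-- `PSPACE` is closed under complement: `co PSPACE = PSPACE` (swap the answer of a
deterministic decider). [Arora–Barak 2009, §4.1; Sipser, §8.2] [cite: AroraBarak2009, §4.1] -/
def co_PSPACE : Prop :=
  co PSPACE = PSPACE

end Literature.Computability.Complexity
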